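import Mathlib
import Summits.Ventures.PercRepro2.CoinChainXAOmega
import Summits.Ventures.PercRepro2.CoinKSureLayer

/-!
# (XA′) is a statement about pairs of UP-SETS (blind cell PercRepro2, night-2 g27; proofs/NIGHT2-DARC.md §68.6)

The cleared (XA′) expression `a0·U001 − Cross` is BILINEAR in the markers `(x, y)`: by the Ω-identity
(`xa_omega_identity`) it is `∑_W (a0·Ω̂_y(W) − |Ω̂_y|·R0 W)·x W`, a linear functional of `x` whose
coefficient depends on `y` only (`xa_linear_in_x`), and it is symmetric in `x ↔ y` (`xa_symm`).  Hence
the discrete layer cake (`sum_mul_nonneg_of_levels`: `x = ∑_t 1[x ≥ t]`, every level set of an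
increasing marker an up-set) reduces (XA′) for all nonnegative increasing markers to (XA′) for all
pairs of `{0,1}`-valued increasing markers — all pairs of up-set indicators (`xa_of_upsets`): the
crux of the general AND-switch chain is a finite family of polynomial inequalities in the masses of
the four laws on the cells `{𝒳, 𝒳ᶜ} × {𝒴, 𝒴ᶜ} × regions`.
-/

namespace Summit.Ventures.PercRepro2.Coin

open Classical

section XALinear

variable {V : Type*} {R : Type*} [CommRing R]

/-- The cleared (XA′) expression as a LINEAR FUNCTIONAL of `x` (for fixed laws and `y`):
`a0·U001 − Cross = ∑_W (a0·Ω̂ W − (∑ Ω̂)·R0 W)·x W`, with `Ω̂` the Ω-law of `xa_omega_identity`. -/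
theorem xa_linear_in_x (U : Finset V) (R0 R1 G0 G1 x y : Finset V → R) :
    (∑ W ∈ U.powerset, R0 W) * ((∑ W ∈ U.powerset, R0 W) * (∑ W ∈ U.powerset, R0 W) * (∑ W ∈ U.powerset, G1 W * (x W * y W)) - (∑ W ∈ U.powerset, R0 W) * (∑ W ∈ U.powerset, R0 W * y W) * (∑ W ∈ U.powerset, G1 W * x W) - (∑ W ∈ U.powerset, R0 W) * (∑ W ∈ U.powerset, R0 W * x W) * (∑ W ∈ U.powerset, G1 W * y W) + (∑ W ∈ U.powerset, R0 W * x W) * (∑ W ∈ U.powerset, R0 W * y W) * (∑ W ∈ U.powerset, G1 W)) - (((∑ W ∈ U.powerset, R0 W) * (∑ W ∈ U.powerset, R1 W * x W) - (∑ W ∈ U.powerset, R0 W * x W) * (∑ W ∈ U.powerset, R1 W)) * ((∑ W ∈ U.powerset, R0 W) * (∑ W ∈ U.powerset, G0 W * y W) - (∑ W ∈ U.powerset, R0 W * y W) * (∑ W ∈ U.powerset, G0 W)) + ((∑ W ∈ U.powerset, R0 W) * (∑ W ∈ U.powerset, R1 W * y W) - (∑ W ∈ U.powerset, R0 W * y W)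 * (∑ W ∈ U.powerset, R1 W)) * ((∑ W ∈ U.powerset, R0 W) * (∑ W ∈ U.powerset, G0 W * x W) - (∑ W ∈ U.powerset, R0 W * x W) * (∑ W ∈ U.powerset, G0 W)))
    = ∑ W ∈ U.powerset, ((∑ W ∈ U.powerset, R0 W) * ((∑ W ∈ U.powerset, R0 W) ^ 2 * G1 W * y W + (∑ W ∈ U.powerset, R0 W) * (∑ W ∈ U.powerset, R0 W * y W) * (R1 W - G1 W - R0 W + G0 W) + ((∑ W ∈ U.powerset, R0 W) * (∑ W ∈ U.powerset, G0 W * y W) + (∑ W ∈ U.powerset, R0 W * y W) * ((∑ W ∈ U.powerset, R0 W) - (∑ W ∈ U.powerset, G0 W))) * (R0 W - R1 W) + ((∑ W ∈ U.powerset, R0 W) * (∑ W ∈ U.powerset, R1 W * y W) + (∑ W ∈ U.powerset, R0 W * y W) * ((∑ W ∈ U.powerset, R0 W) - (∑ W ∈ U.powerset, R1 W))) * (R0 W - G0 W)) - (∑ W' ∈ U.powerset, ((∑ W ∈ U.powerset, R0 W) ^ 2 * G1 W' * y W' + (∑ W ∈ U.powerset, R0 W) * (∑ W ∈ U.powerset,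 R0 W * y W) * (R1 W' - G1 W' - R0 W' + G0 W') + ((∑ W ∈ U.powerset, R0 W) * (∑ W ∈ U.powerset, G0 W * y W) + (∑ W ∈ U.powerset, R0 W * y W) * ((∑ W ∈ U.powerset, R0 W) - (∑ W ∈ U.powerset, G0 W))) * (R0 W' - R1 W') + ((∑ W ∈ U.powerset, R0 W) * (∑ W ∈ U.powerset, R1 W * y W) + (∑ W ∈ U.powerset, R0 W * y W) * ((∑ W ∈ U.powerset, R0 W) - (∑ W ∈ U.powerset, R1 W))) * (R0 W' - G0 W'))) * R0 W) * x W := by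
  rw [xa_omega_identity U R0 R1 G0 G1 x y _ _ _ _ _ _ _ _ _ _ _ _ _ rfl rfl rfl rfl rfl rfl rfl rfl rfl rfl rfl rfl rfl]
  set a0 := ∑ W ∈ U.powerset, R0 W with ha0
  set a1 := ∑ W ∈ U.powerset, R0 W * x W with ha1
  set Ω : Finset V → R := fun W => a0 ^ 2 * G1 W * y W
      + a0 * (∑ W ∈ U.powerset, R0 W * y W) * (R1 W - G1 W - R0 W + G0 W)
      + (a0 * (∑ W ∈ U.powerset, G0 W * y W) + (∑ W ∈ U.powerset, R0 W * y W) * (a0 - ∑ W ∈ U.powerset, G0 W)) * (R0 W - R1 W)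
      + (a0 * (∑ W ∈ U.powerset, R1 W * y W) + (∑ W ∈ U.powerset, R0 W * y W) * (a0 - ∑ W ∈ U.powerset, R1 W)) * (R0 W - G0 W) with hΩ
  have h1 : ∑ W ∈ U.powerset, Ω W * (a0 * x W - a1) = a0 * ∑ W ∈ U.powerset, Ω W * x W - a1 * ∑ W ∈ U.powerset, Ω W := by
    simp only [mul_sub, Finset.sum_sub_distrib, Finset.mul_sum]
    congr 1
    · exact Finset.sum_congr rfl fun W _ => by ring
    · exact Finset.sum_congr rfl fun W _ => by ring
  have h2 : ∑ W ∈ U.powerset, (a0 * Ω W - (∑ W' ∈ U.powerset, Ω W') * R0 W) * x W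
      = a0 * ∑ W ∈ U.powerset, Ω W * x W - (∑ W' ∈ U.powerset, Ω W') * a1 := by
    rw [ha1]
    simp only [sub_mul, Finset.sum_sub_distrib, Finset.mul_sum]
    congr 1
    · exact Finset.sum_congr rfl fun W _ => by ring
    · exact Finset.sum_congr rfl fun W _ => by ring
  rw [h1, h2]; ring

/-- The cleared (XA′) expression is SYMMETRIC in the two markers. -/
theorem xa_symm (U : Finset V) (R0 R1 G0 G1 x y : Finset V → R) :
    (∑ W ∈ U.powerset, R0 W) * ((∑ W ∈ U.powerset, R0 W) * (∑ W ∈ U.powerset, R0 W) * (∑ W ∈ U.powerset, G1 W * (x W * y W)) - (∑ W ∈ U.powerset, R0 W) * (∑ W ∈ U.powerset, R0 W * y W) * (∑ W ∈ U.powerset, G1 W * x W) - (∑ W ∈ U.powerset, R0 W) * (∑ W ∈ U.powerset, R0 W * x W) * (∑ W ∈ U.powerset, G1 W * y W) + (∑ W ∈ U.powerset, R0 W * x W) * (∑ W ∈ U.powerset, R0 W * y W) * (∑ W ∈ U.powerset, G1 W)) - (((∑ W ∈ U.powerset, R0 W) * (∑ W ∈ U.powerset, R1 W * x W) - (∑ W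 ∈ U.powerset, R0 W * x W) * (∑ W ∈ U.powerset, R1 W)) * ((∑ W ∈ U.powerset, R0 W) * (∑ W ∈ U.powerset, G0 W * y W) - (∑ W ∈ U.powerset, R0 W * y W) * (∑ W ∈ U.powerset, G0 W)) + ((∑ W ∈ U.powerset, R0 W) * (∑ W ∈ U.powerset, R1 W * y W) - (∑ W ∈ U.powerset, R0 W * y W) * (∑ W ∈ U.powerset, R1 W)) * ((∑ W ∈ U.powerset, R0 W) * (∑ W ∈ U.powerset, G0 W * x W) - (∑ W ∈ U.powerset, R0 W * x W) * (∑ W ∈ U.powerset, G0 W))) = (∑ W ∈ U.powerset, R0 W) * ((∑ W ∈ U.powerset, R0 W) * (∑ W ∈ U.powerset, R0 W) * (∑ W ∈ U.powerset, G1 W * (y W * x W)) - (∑ W ∈ U.powerset, R0 W) * (∑ W ∈ U.powerset, R0 W * x W) * (∑ W ∈ U.powerset, G1 W * y W) - (∑ W ∈ U.powerset, R0 W) * (∑ W ∈ U.powerset, R0 W * y W) * (∑ W ∈ U.powerset, G1 W * x W) + (∑ W ∈ U.powerset, R0 W * y W) * (∑ W ∈ U.powerset, R0 W * x W) * (∑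 W ∈ U.powerset, G1 W)) - (((∑ W ∈ U.powerset, R0 W) * (∑ W ∈ U.powerset, R1 W * y W) - (∑ W ∈ U.powerset, R0 W * y W) * (∑ W ∈ U.powerset, R1 W)) * ((∑ W ∈ U.powerset, R0 W) * (∑ W ∈ U.powerset, G0 W * x W) - (∑ W ∈ U.powerset, R0 W * x W) * (∑ W ∈ U.powerset, G0 W)) + ((∑ W ∈ U.powerset, R0 W) * (∑ W ∈ U.powerset, R1 W * x W) - (∑ W ∈ U.powerset, R0 W * x W) * (∑ W ∈ U.powerset, R1 W)) * ((∑ W ∈ U.powerset, R0 W) * (∑ W ∈ U.powerset, G0 W * y W) - (∑ W ∈ U.powerset, R0 W * y W) * (∑ W ∈ U.powerset, G0 W))) := by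
  have h : ∑ W ∈ U.powerset, G1 W * (x W * y W) = ∑ W ∈ U.powerset, G1 W * (y W * x W) :=
    Finset.sum_congr rfl fun W _ => by ring
  rw [h]; ring

end XALinear

section XAUpsets

variable {V : Type*} [DecidableEq V] {R : Type*} [Field R] [LinearOrder R] [IsStrictOrderedRing R]

/-- **THE LAYER CAKE FOR A LINEAR FUNCTIONAL.** If `∑ c W · x' W ≥ 0` for every `{0,1}`-valued
increasing `x'`, then `∑ c W · x W ≥ 0` for every nonnegative increasing `x` (the level sets
`{t ≤ x}`, `t > 0`, are up-sets; `sum_mul_nonneg_of_levels` with `w₀ = 0`). -/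
theorem linear_nonneg_of_indicators (U : Finset V) (c x : Finset V → R)
    (hx0 : ∀ W, 0 ≤ x W) (hxm : ∀ s t, x s ≤ x (s ∪ t))
    (hind : ∀ x' : Finset V → R, (∀ W, x' W = 0 ∨ x' W = 1) → (∀ s t, x' s ≤ x' (s ∪ t)) →
      0 ≤ ∑ W ∈ U.powerset, c W * x' W) :
    0 ≤ ∑ W ∈ U.powerset, c W * x W := by
  refine sum_mul_nonneg_of_levels U.powerset c x 0 (fun W _ _ => hx0 W) (by simp) ?_
  intro t ht
  have key := hind (fun W => if t ≤ x W then 1 else 0) (fun W => by by_cases h : t ≤ x W <;> simp [h])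
    (fun s u => by
      by_cases h : t ≤ x s
      · have : t ≤ x (s ∪ u) := le_trans h (hxm s u)
        simp [h, this]
      · by_cases h' : t ≤ x (s ∪ u) <;> simp [h, h'])
  simpa [Finset.sum_filter, mul_ite] using key

/-- **(XA′) FROM UP-SET INDICATORS IN `x`** (fixed `y`). -/
theorem xa_of_indicator_x (U : Finset V) (R0 R1 G0 G1 x y : Finset V → R)
    (hx0 : ∀ W, 0 ≤ x W) (hxm : ∀ s t, x s ≤ x (s ∪ t))
    (hind : ∀ x' : Finset V → R, (∀ W, x' W = 0 ∨ x' W = 1) → (∀ s t, x' s ≤ x' (s ∪ t)) →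
      0 ≤ (∑ W ∈ U.powerset, R0 W) * ((∑ W ∈ U.powerset, R0 W) * (∑ W ∈ U.powerset, R0 W) * (∑ W ∈ U.powerset, G1 W * (x' W * y W)) - (∑ W ∈ U.powerset, R0 W) * (∑ W ∈ U.powerset, R0 W * y W) * (∑ W ∈ U.powerset, G1 W * x' W) - (∑ W ∈ U.powerset, R0 W) * (∑ W ∈ U.powerset, R0 W * x' W) * (∑ W ∈ U.powerset, G1 W * y W) + (∑ W ∈ U.powerset, R0 W * x' W) * (∑ W ∈ U.powerset, R0 W * y W) * (∑ W ∈ U.powerset, G1 W)) - (((∑ W ∈ U.powerset, R0 W) * (∑ W ∈ U.powerset, R1 W * x' W) - (∑ W ∈ U.powerset, R0 W * x' W) * (∑ W ∈ U.powerset, R1 W)) * ((∑ W ∈ U.powerset, R0 W) * (∑ W ∈ U.powerset, G0 W * y W) - (∑ W ∈ U.powerset, R0 W * y W) * (∑ W ∈ U.powerset, G0 W)) + ((∑ W ∈ U.powerset, R0 W) * (∑ W ∈ U.powerset, R1 W * y W) - (∑ W ∈ U.powerset, R0 W * y W) * (∑ W ∈ U.powerset, R1 W)) * ((∑ W ∈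 U.powerset, R0 W) * (∑ W ∈ U.powerset, G0 W * x' W) - (∑ W ∈ U.powerset, R0 W * x' W) * (∑ W ∈ U.powerset, G0 W)))) :
    0 ≤ (∑ W ∈ U.powerset, R0 W) * ((∑ W ∈ U.powerset, R0 W) * (∑ W ∈ U.powerset, R0 W) * (∑ W ∈ U.powerset, G1 W * (x W * y W)) - (∑ W ∈ U.powerset, R0 W) * (∑ W ∈ U.powerset, R0 W * y W) * (∑ W ∈ U.powerset, G1 W * x W) - (∑ W ∈ U.powerset, R0 W) * (∑ W ∈ U.powerset, R0 W * x W) * (∑ W ∈ U.powerset, G1 W * y W) + (∑ W ∈ U.powerset, R0 W * x W) * (∑ W ∈ U.powerset, R0 W * y W) * (∑ W ∈ U.powerset, G1 W)) - (((∑ W ∈ U.powerset, R0 W) * (∑ W ∈ U.powerset, R1 W * x W) - (∑ W ∈ U.powerset, R0 W * x W) * (∑ W ∈ U.powerset, R1 W)) * ((∑ W ∈ U.powerset, R0 W) * (∑ W ∈ U.powerset, G0 W * y W) - (∑ W ∈ U.powerset, R0 W * y W) * (∑ W ∈ U.powerset, G0 W)) + ((∑ W ∈ U.powerset, R0 W)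 * (∑ W ∈ U.powerset, R1 W * y W) - (∑ W ∈ U.powerset, R0 W * y W) * (∑ W ∈ U.powerset, R1 W)) * ((∑ W ∈ U.powerset, R0 W) * (∑ W ∈ U.powerset, G0 W * x W) - (∑ W ∈ U.powerset, R0 W * x W) * (∑ W ∈ U.powerset, G0 W))) := by
  rw [xa_linear_in_x]
  refine linear_nonneg_of_indicators U _ x hx0 hxm ?_
  intro x' h01 hm
  rw [← xa_linear_in_x]
  exact hind x' h01 hm

/-- **(XA′) FROM UP-SET INDICATORS IN `y`** (fixed `x`), by the symmetry `xa_symm`. -/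
theorem xa_of_indicator_y (U : Finset V) (R0 R1 G0 G1 x y : Finset V → R)
    (hy0 : ∀ W, 0 ≤ y W) (hym : ∀ s t, y s ≤ y (s ∪ t))
    (hind : ∀ y' : Finset V → R, (∀ W, y' W = 0 ∨ y' W = 1) → (∀ s t, y' s ≤ y' (s ∪ t)) →
      0 ≤ (∑ W ∈ U.powerset, R0 W) * ((∑ W ∈ U.powerset, R0 W) * (∑ W ∈ U.powerset, R0 W) * (∑ W ∈ U.powerset, G1 W * (x W * y' W)) - (∑ W ∈ U.powerset, R0 W) * (∑ W ∈ U.powerset, R0 W * y' W) * (∑ W ∈ U.powerset, G1 W * x W) - (∑ W ∈ U.powerset, R0 W) * (∑ W ∈ U.powerset, R0 W * x W) * (∑ W ∈ U.powerset, G1 W * y' W) + (∑ W ∈ U.powerset, R0 W * x W) * (∑ W ∈ U.powerset, R0 W * y' W) * (∑ W ∈ U.powerset, G1 W)) - (((∑ W ∈ U.powerset, R0 W) * (∑ W ∈ U.powerset, R1 W * x W) - (∑ W ∈ U.powerset, R0 W * x W) * (∑ W ∈ U.powerset, R1 W)) * ((∑ W ∈ U.powerset, R0 W) * (∑ W ∈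 U.powerset, G0 W * y' W) - (∑ W ∈ U.powerset, R0 W * y' W) * (∑ W ∈ U.powerset, G0 W)) + ((∑ W ∈ U.powerset, R0 W) * (∑ W ∈ U.powerset, R1 W * y' W) - (∑ W ∈ U.powerset, R0 W * y' W) * (∑ W ∈ U.powerset, R1 W)) * ((∑ W ∈ U.powerset, R0 W) * (∑ W ∈ U.powerset, G0 W * x W) - (∑ W ∈ U.powerset, R0 W * x W) * (∑ W ∈ U.powerset, G0 W)))) :
    0 ≤ (∑ W ∈ U.powerset, R0 W) * ((∑ W ∈ U.powerset, R0 W) * (∑ W ∈ U.powerset, R0 W) * (∑ W ∈ U.powerset, G1 W * (x W * y W)) - (∑ W ∈ U.powerset, R0 W) * (∑ W ∈ U.powerset, R0 W * y W) * (∑ W ∈ U.powerset, G1 W * x W) - (∑ W ∈ U.powerset, R0 W) * (∑ W ∈ U.powerset, R0 W * x W) * (∑ W ∈ U.powerset, G1 W * y W) + (∑ W ∈ U.powerset, R0 W * x W) * (∑ W ∈ U.powerset, R0 W * y W) * (∑ W ∈ U.powerset, G1 W)) - (((∑ W ∈ U.powerset, R0 W) * (∑ W ∈ U.powerset, R1 W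 * x W) - (∑ W ∈ U.powerset, R0 W * x W) * (∑ W ∈ U.powerset, R1 W)) * ((∑ W ∈ U.powerset, R0 W) * (∑ W ∈ U.powerset, G0 W * y W) - (∑ W ∈ U.powerset, R0 W * y W) * (∑ W ∈ U.powerset, G0 W)) + ((∑ W ∈ U.powerset, R0 W) * (∑ W ∈ U.powerset, R1 W * y W) - (∑ W ∈ U.powerset, R0 W * y W) * (∑ W ∈ U.powerset, R1 W)) * ((∑ W ∈ U.powerset, R0 W) * (∑ W ∈ U.powerset, G0 W * x W) - (∑ W ∈ U.powerset, R0 W * x W) * (∑ W ∈ U.powerset, G0 W))) := by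
  rw [xa_symm]
  refine xa_of_indicator_x U R0 R1 G0 G1 y x hy0 hym ?_
  intro y' h01 hm
  rw [xa_symm]
  exact hind y' h01 hm

/-- **(XA′) FOR ALL MARKERS FROM (XA′) FOR ALL PAIRS OF UP-SET INDICATORS.**  The cleared (XA′)
inequality `Cross ≤ a0·U001` for all nonnegative increasing markers follows from its instances at
`{0,1}`-valued increasing markers (the indicators of up-sets of clusters): bilinearity plus the layer
cake in each variable. -/
theorem xa_of_upsets (U : Finset V) (R0 R1 G0 G1 : Finset V → R)
    (hind : ∀ x' y' : Finset V → R, (∀ W, x' W = 0 ∨ x' W = 1) → (∀ W, y' W = 0 ∨ y' W = 1) →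
      (∀ s t, x' s ≤ x' (s ∪ t)) → (∀ s t, y' s ≤ y' (s ∪ t)) → 0 ≤ (∑ W ∈ U.powerset, R0 W) * ((∑ W ∈ U.powerset, R0 W) * (∑ W ∈ U.powerset, R0 W) * (∑ W ∈ U.powerset, G1 W * (x' W * y' W)) - (∑ W ∈ U.powerset, R0 W) * (∑ W ∈ U.powerset, R0 W * y' W) * (∑ W ∈ U.powerset, G1 W * x' W) - (∑ W ∈ U.powerset, R0 W) * (∑ W ∈ U.powerset, R0 W * x' W) * (∑ W ∈ U.powerset, G1 W * y' W) + (∑ W ∈ U.powerset, R0 W * x' W) * (∑ W ∈ U.powerset, R0 W * y' W) * (∑ W ∈ U.powerset, G1 W)) - (((∑ W ∈ U.powerset, R0 W) * (∑ W ∈ U.powerset, R1 W * x' W) - (∑ W ∈ U.powerset, R0 W * x' W) * (∑ W ∈ U.powerset, R1 W)) * ((∑ W ∈ U.powerset, R0 W) * (∑ W ∈ U.powerset, G0 W * y' W) - (∑ W ∈ U.powerset, R0 W * y' W) * (∑ W ∈ U.powerset, G0 W)) + ((∑ W ∈ U.powerset, R0 W) * (∑ W ∈ U.powerset, R1 W *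 y' W) - (∑ W ∈ U.powerset, R0 W * y' W) * (∑ W ∈ U.powerset, R1 W)) * ((∑ W ∈ U.powerset, R0 W) * (∑ W ∈ U.powerset, G0 W * x' W) - (∑ W ∈ U.powerset, R0 W * x' W) * (∑ W ∈ U.powerset, G0 W))))
    (x y : Finset V → R) (hx0 : ∀ W, 0 ≤ x W) (hy0 : ∀ W, 0 ≤ y W)
    (hxm : ∀ s t, x s ≤ x (s ∪ t)) (hym : ∀ s t, y s ≤ y (s ∪ t)) :
    0 ≤ (∑ W ∈ U.powerset, R0 W) * ((∑ W ∈ U.powerset, R0 W) * (∑ W ∈ U.powerset, R0 W) * (∑ W ∈ U.powerset, G1 W * (x W * y W)) - (∑ W ∈ U.powerset, R0 W) * (∑ W ∈ U.powerset, R0 W * y W) * (∑ W ∈ U.powerset, G1 W * x W) - (∑ W ∈ U.powerset, R0 W) * (∑ W ∈ U.powerset, R0 W * x W) * (∑ W ∈ U.powerset, G1 W * y W) + (∑ W ∈ U.powerset, R0 W * x W) * (∑ W ∈ U.powerset, R0 W * y W) * (∑ W ∈ U.powerset, G1 W)) - (((∑ W ∈ U.powerset, R0 W) * (∑ W ∈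 U.powerset, R1 W * x W) - (∑ W ∈ U.powerset, R0 W * x W) * (∑ W ∈ U.powerset, R1 W)) * ((∑ W ∈ U.powerset, R0 W) * (∑ W ∈ U.powerset, G0 W * y W) - (∑ W ∈ U.powerset, R0 W * y W) * (∑ W ∈ U.powerset, G0 W)) + ((∑ W ∈ U.powerset, R0 W) * (∑ W ∈ U.powerset, R1 W * y W) - (∑ W ∈ U.powerset, R0 W * y W) * (∑ W ∈ U.powerset, R1 W)) * ((∑ W ∈ U.powerset, R0 W) * (∑ W ∈ U.powerset, G0 W * x W) - (∑ W ∈ U.powerset, R0 W * x W) * (∑ W ∈ U.powerset, G0 W))) := by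
  refine xa_of_indicator_x U R0 R1 G0 G1 x y hx0 hxm ?_
  intro x' hx'01 hx'm
  refine xa_of_indicator_y U R0 R1 G0 G1 x' y hy0 hym ?_
  intro y' hy'01 hy'm
  exact hind x' y' hx'01 hy'01 hx'm hy'm

end XAUpsets

section XAUpsetsChain

variable {V : Type*} [DecidableEq V] {R : Type*} [Field R] [LinearOrder R] [IsStrictOrderedRing R]

/-- **THE GENERAL AND-SWITCH CHAIN FROM (XA′) AT ALL PAIRS OF UP-SET INDICATORS.** If
`Cross ≤ a0·U001` holds on the chain data for every pair of `{0,1}`-valued increasing markers, then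
it holds for the given nonnegative increasing markers (`xa_of_upsets`) and the chain functional is
nonnegative at every `ρ ∈ [0, 1]` (`chain_functional_nonneg_of_XA'`). -/
theorem chain_functional_nonneg_of_upsets (U ent ent' : Finset V) (ν c d d' : Finset V → R)
    (ρ : R) (hρ0 : 0 ≤ ρ) (hρ1 : ρ ≤ 1) (hν0 : ∀ W, 0 ≤ ν W)
    (hν : ∀ s ⊆ U, ∀ t ⊆ U, ν s * ν t ≤ ν (s ∩ t) * ν (s ∪ t))
    (hc0 : ∀ W, 0 ≤ c W) (hd0 : ∀ W, 0 ≤ d W) (hd'0 : ∀ W, 0 ≤ d' W)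
    (hdc : ∀ W, d W ≤ c W) (hd'c : ∀ W, d' W ≤ c W) (hd'd : ∀ W, d' W ≤ d W)
    (hcc : ∀ s t, c s * c t ≤ c (s ∩ t) * c (s ∪ t))
    (hdd : ∀ s t, d s * d t ≤ d (s ∩ t) * d (s ∪ t))
    (hd'd' : ∀ s t, d' s * d' t ≤ d' (s ∩ t) * d' (s ∪ t))
    (hcd : ∀ s t, c s * d t ≤ c (s ∩ t) * d (s ∪ t))
    (hcd' : ∀ s t, c s * d' t ≤ c (s ∩ t) * d' (s ∪ t))
    (hdd' : ∀ s t, d s * d' t ≤ d (s ∩ t) * d' (s ∪ t))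
    (hratio : ∀ s t, s ⊆ t → d s * c t ≤ c s * d t)
    (hratio' : ∀ s t, s ⊆ t → d' s * c t ≤ c s * d' t)
    (x y : Finset V → R) (hx0 : ∀ W, 0 ≤ x W) (hy0 : ∀ W, 0 ≤ y W)
    (hxm : ∀ s t, x s ≤ x (s ∪ t)) (hym : ∀ s t, y s ≤ y (s ∪ t))
    (hpos0 : 0 < ∑ W ∈ U.powerset, ν W * chainMix ent ent' 0 c d W)
    (hpos1 : 0 < ∑ W ∈ U.powerset, ν W * chainMix ent ent' 1 c d W)
    (hmI : 0 < ∑ W ∈ U.powerset.filter (fun W => ¬ ∃ r ∈ ent ∪ ent', r ∈ W), ν W * c W)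
    (hup : ∀ x' y' : Finset V → R, (∀ W, x' W = 0 ∨ x' W = 1) → (∀ W, y' W = 0 ∨ y' W = 1) →
      (∀ s t, x' s ≤ x' (s ∪ t)) → (∀ s t, y' s ≤ y' (s ∪ t)) →
      (((∑ W ∈ U.powerset, ν W * chainMix ent ent' 0 c d W) * (∑ W ∈ U.powerset, ν W * chainMix ent ent' 1 c d W * x' W) - (∑ W ∈ U.powerset, ν W * chainMix ent ent' 0 c d W * x' W) * (∑ W ∈ U.powerset, ν W * chainMix ent ent' 1 c d W)) * ((∑ W ∈ U.powerset, ν W * chainMix ent ent' 0 c d W) * (∑ W ∈ U.powerset, ν W * chainMix ent ent' 0 c d' W * y' W) - (∑ W ∈ U.powerset, ν W * chainMix ent ent' 0 c d W * y' W) * (∑ W ∈ U.powerset, ν W * chainMix ent ent' 0 c d' W)) + ((∑ W ∈ U.powerset, ν W * chainMix ent ent' 0 c d W) * (∑ W ∈ U.powerset, ν W * chainMix ent ent' 1 c d W * y' W) - (∑ W ∈ U.powerset, ν W * chainMix ent ent' 0 c d W * y' W) * (∑ W ∈ U.powerset, ν W * chainMix ent ent' 1 c d W)) * ((∑ W ∈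 U.powerset, ν W * chainMix ent ent' 0 c d W) * (∑ W ∈ U.powerset, ν W * chainMix ent ent' 0 c d' W * x' W) - (∑ W ∈ U.powerset, ν W * chainMix ent ent' 0 c d W * x' W) * (∑ W ∈ U.powerset, ν W * chainMix ent ent' 0 c d' W))) ≤ (∑ W ∈ U.powerset, ν W * chainMix ent ent' 0 c d W) * ((∑ W ∈ U.powerset, ν W * chainMix ent ent' 0 c d W) * (∑ W ∈ U.powerset, ν W * chainMix ent ent' 0 c d W) * (∑ W ∈ U.powerset, ν W * chainMix ent ent' 1 c d' W * (x' W * y' W)) - (∑ W ∈ U.powerset, ν W * chainMix ent ent' 0 c d W) * (∑ W ∈ U.powerset, ν W * chainMix ent ent' 0 c d W * y' W) * (∑ W ∈ U.powerset, ν W * chainMix ent ent' 1 c d' W * x' W) - (∑ W ∈ U.powerset, ν W * chainMix ent ent' 0 c d W) * (∑ W ∈ U.powerset, ν W * chainMix ent ent' 0 c d W * x' W) * (∑ W ∈ U.powerset, ν W * chainMix ent ent' 1 c d' W * y' W) + (∑ W ∈ U.powerset, ν W * chainMix ent ent' 0 c d W * x' W) * (∑ W ∈ U.powerset, ν W * chainMix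 ent ent' 0 c d W * y' W) * (∑ W ∈ U.powerset, ν W * chainMix ent ent' 1 c d' W))) :
    0 ≤ (∑ W ∈ U.powerset, ν W * chainMix ent ent' ρ c d W) ^ 2 *
          (∑ W ∈ U.powerset, ν W * chainMix ent ent' ρ c d' W * (x W * y W))
        - (∑ W ∈ U.powerset, ν W * chainMix ent ent' ρ c d W) *
          (∑ W ∈ U.powerset, ν W * chainMix ent ent' ρ c d W * x W) *
          (∑ W ∈ U.powerset, ν W * chainMix ent ent' ρ c d' W * y W)
        - (∑ W ∈ U.powerset, ν W * chainMix ent ent' ρ c d W) *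
          (∑ W ∈ U.powerset, ν W * chainMix ent ent' ρ c d W * y W) *
          (∑ W ∈ U.powerset, ν W * chainMix ent ent' ρ c d' W * x W)
        + (∑ W ∈ U.powerset, ν W * chainMix ent ent' ρ c d W * x W) *
          (∑ W ∈ U.powerset, ν W * chainMix ent ent' ρ c d W * y W) *
          (∑ W ∈ U.powerset, ν W * chainMix ent ent' ρ c d' W) := by
  refine chain_functional_nonneg_of_XA' U ent ent' ν c d d' ρ hρ0 hρ1 hν0 hν hc0 hd0 hd'0 hdc
    hd'c hd'd hcc hdd hd'd' hcd hcd' hdd' hratio hratio' x y hx0 hy0 hxm hym hpos0 hpos1 hmI ?_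
  have key := xa_of_upsets U (fun W => ν W * chainMix ent ent' 0 c d W)
    (fun W => ν W * chainMix ent ent' 1 c d W) (fun W => ν W * chainMix ent ent' 0 c d' W)
    (fun W => ν W * chainMix ent ent' 1 c d' W)
    (fun x' y' h1 h2 h3 h4 => sub_nonneg.mpr (hup x' y' h1 h2 h3 h4)) x y hx0 hy0 hxm hym
  exact sub_nonneg.mp key

end XAUpsetsChain

end Summit.Ventures.PercRepro2.Coin
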